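import Mathlib
import Summits.QuantumFields.YangMills.Theorems.MirrorModularBoostsPlanarSpectralConeConeOfDiscSections
import HarnessLib

/-!
# The lever `stub_cone_of_discSections`, delayed form — line `positivity-disc-to-operator-cone`
# of crux `MirrorModularBoosts.PlanarSpectralCone` (stmt-QuantumFields-9664)

A finite positive measure `μ` on energy–momentum space `ℝ⁴` carried by `{p₀ ≥ 0}` whose
Fourier–Laplace sections `b ↦ ∫ e^{-tp₀+ibp₁} dμ` are, for every `t > c` (a delay `c ≥ 0`),
restrictions of functions holomorphic on the disc `|β| < t - c` and bounded there by ONE constant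
`M`, charges nothing outside the closed planar cone: `μ {p₀ < |p₁|} = 0`.

Proof: REDUCTION OF THE DELAY to the undelayed lever already in the tree
(`TwoMirrorLightconeSlots.stub_cone_of_discSections`, file
`Theorems/MirrorModularBoostsPlanarSpectralConeConeOfDiscSections.lean`: Lukacs' theorem on
analytic characteristic functions + ray asymptotics). The damped measure `μ_c := e^{-cp₀} μ` is
finite, is carried by `{p₀ ≥ 0}`, and its section at level `t > 0` is the section of `μ` at level
`t + c > c`, so `μ_c` has UNDELAYED disc sections of radius `t` with the same bound `M`; hence
`μ_c {p₀ < |p₁|} = 0`, and `μ_c`, `μ` have the same null sets (the density is everywhere positive).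
-/

noncomputable section

namespace Summit.QuantumFields.YangMills.Cruxes.PlanarSpectralCone.PositivityDiscToOperatorCone

open MeasureTheory
open scoped ENNReal

/-- Euclidean `ℝ⁴`, time = coordinate `0`, the boost plane = coordinates `0, 1`. -/
local notation "E4" => EuclideanSpace ℝ (Fin 4)

/-- **Stub 2 — THE LEVER: disc ⇒ strip ⇒ cone by positivity** (pure measure theory on `ℝ⁴`).
A finite positive measure `μ` on energy–momentum space carried by `{p₀ ≥ 0}` whose Fourier–Laplace
sections `b ↦ ∫ e^{-tp₀+ibp₁} dμ`, for every `t > c`, are restrictions of functions holomorphic on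
the disc `|β| < t - c` and bounded there by ONE constant `M`, charges nothing outside the closed
planar cone: `μ{p₀ < |p₁|} = 0`. Proof: the damped measure `μ_c = e^{-cp₀} μ` is finite, carried
by `{p₀ ≥ 0}`, and has undelayed disc sections with the same bound (its level-`t` section is the
level-`(t + c)` section of `μ`), so the undelayed lever
`TwoMirrorLightconeSlots.stub_cone_of_discSections` makes `{p₀ < |p₁|}` `μ_c`-null; the density
`e^{-cp₀}` is everywhere positive, so the set is `μ`-null. -/
theorem stub_cone_of_discSections (μ : Measure E4) [IsFiniteMeasure μ]
    (hE : μ {p | p 0 < 0} = 0) (c M : ℝ) (hc : 0 ≤ c)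
    (hdisc : ∀ t : ℝ, c < t → ∃ f : ℂ → ℂ,
      DifferentiableOn ℂ f (Metric.ball 0 (t - c)) ∧
        (∀ z ∈ Metric.ball (0 : ℂ) (t - c), ‖f z‖ ≤ M) ∧
          ∀ b : ℝ, |b| < t - c →
            f b = ∫ p, Complex.exp ((((-(t * p 0) : ℝ)) : ℂ) + ((b * p 1 : ℝ) : ℂ) * Complex.I) ∂μ) :
    μ {p | p 0 < |p 1|} = 0 := by
  -- the damping density `e^{-cp₀}` and the damped measure `μ_c`
  obtain ⟨d, hd⟩ : ∃ d : E4 → ℝ≥0∞, d = fun p => ENNReal.ofReal (Real.exp (-(c * p 0))) :=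
    ⟨_, rfl⟩
  have hd_meas : Measurable d := by
    rw [hd]
    exact ENNReal.measurable_ofReal.comp
      (by fun_prop : Continuous fun p : E4 => Real.exp (-(c * p 0))).measurable
  obtain ⟨μc, hμc⟩ : ∃ μc : Measure E4, μc = μ.withDensity d := ⟨_, rfl⟩
  -- `μ_c` is finite: the density is at most `1` almost everywhere
  haveI : IsFiniteMeasure μc := by
    rw [hμc, hd]
    refine isFiniteMeasure_withDensity_ofReal (HasFiniteIntegral.of_bounded (C := 1) ?_)
    have hae : ∀ᵐ p ∂μ, 0 ≤ p 0 := by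
      rw [ae_iff]
      simpa only [not_le] using hE
    filter_upwards [hae] with p hp
    rw [Real.norm_eq_abs, abs_of_pos (Real.exp_pos _), Real.exp_le_one_iff, neg_nonpos]
    exact mul_nonneg hc hp
  -- `μ_c` is carried by `{p₀ ≥ 0}`
  have hEc : μc {p | p 0 < 0} = 0 := by
    rw [hμc]
    exact withDensity_absolutelyContinuous μ d hE
  -- `μ_c` has undelayed disc sections: its level-`t` section is the level-`(t + c)` section of `μ`
  have hdiscc : ∀ t : ℝ, 0 < t → ∃ f : ℂ → ℂ,
      DifferentiableOn ℂ f (Metric.ball 0 t) ∧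
        (∀ z ∈ Metric.ball (0 : ℂ) t, ‖f z‖ ≤ M) ∧
          ∀ b : ℝ, |b| < t →
            f b = ∫ p, Complex.exp ((((-(t * p 0) : ℝ)) : ℂ) + ((b * p 1 : ℝ) : ℂ) * Complex.I)
              ∂μc := by
    intro t ht
    obtain ⟨f, hf, hM, hfb⟩ := hdisc (t + c) (by linarith)
    rw [add_sub_cancel_right] at hf hM hfb
    refine ⟨f, hf, hM, fun b hb => ?_⟩
    rw [hfb b hb, hμc, integral_withDensity_eq_integral_toReal_smul hd_meas
      (ae_of_all _ fun p => by rw [hd]; exact ENNReal.ofReal_lt_top)]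
    refine integral_congr_ae (ae_of_all _ fun p => ?_)
    rw [hd]
    dsimp only
    rw [ENNReal.toReal_ofReal (Real.exp_pos _).le, Complex.real_smul, Complex.ofReal_exp,
      ← Complex.exp_add]
    congr 1
    push_cast
    ring
  -- the undelayed lever for `μ_c`, and back to `μ` (the density is everywhere positive)
  have hnull : μc {p | p 0 < |p 1|} = 0 :=
    Summit.QuantumFields.YangMills.Cruxes.PlanarSpectralCone.TwoMirrorLightconeSlots.stub_cone_of_discSections
      μc hEc M hdiscc
  rw [hμc, withDensity_apply_eq_zero hd_meas] at hnull
  refine measure_mono_null (fun p hp => ?_) hnull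
  refine ⟨?_, hp⟩
  show d p ≠ 0
  rw [hd]
  exact (ENNReal.ofReal_pos.2 (Real.exp_pos _)).ne'

end Summit.QuantumFields.YangMills.Cruxes.PlanarSpectralCone.PositivityDiscToOperatorCone
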